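import Summits.BirchSwinnertonDyer.BirchSwinnertonDyer.Theses.CyclotomicUntwist
import Literature.NumberTheory.EllipticCurves.PSLineHeight
import Literature.NumberTheory.EllipticCurves.MordellWeilTheoremProofs
import Literature.Barriers.BirchSwinnertonDyer.PAdicHeightNondegeneracyProofs
import HarnessLib

/-!
# Route `CyclotomicUntwist`, crux K1 `PSRankOneLowerHalfAtThree` (stmt-BirchSwinnertonDyer-21580):
# the D2 hypothesis structure `PSLineHeightData` has NON-DEGENERATE junk inhabitants —
# a line-height datum with `h_χ(P,P) = 1` on every line, from any non-torsion point

Cell `pub/bsd-wall` (D-0145 line `route-BirchSwinnertonDyer-CyclotomicUntwist`), seat `bsd-line-cycu-p4`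
g0 (width attach). THEOREMS ONLY (no definition, no named fact, no `sorry`); helper `--supports` K1 =
stmt-BirchSwinnertonDyer-21580; companion of `CyclotomicUntwistFiniteSlopeSplitVacuity` (§1–§5 there)
and of the memo `K1-SPLIT-VACUITY-v1.md`. BSD is not proved by this file and nothing here is evidence
for or against BSD.

WHAT IS CERTIFIED. D2 (`WeierstrassCurve.PSLineHeightData W R`, Nekovář–Benois line heights as a
hypothesis structure) flags its own vacuity by the ZERO datum. This file shows the opposite junk:
for every coefficient ring `R` over `ℚ₃` and every NON-TORSION point `P ∈ E(ℚ)` there is a datum whose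
pairing is `1` at `(P, P)` on EVERY line `χ` (`χ³ = 1`, `χ ≠ 1`) — the symmetric form `φ ⊗ φ` for an
additive `φ : E(ℚ) → ℚ` with `φ(P) = 1` (Mordell–Weil, tree theorem `module_finite_point_holds`:
`E(ℚ)/tors` is free, so a non-torsion point has a non-zero coordinate), put on the lines and `0` off
them; symmetry, torsion-vanishing, the line clause and the Galois equivariance `h_{σ∘χ} = σ ∘ h_χ`
(`σ` fixes `ℚ ⊂ ℚ₃` and permutes the lines) are immediate. CONSEQUENCE for the CU pen's split spec
(2026-08-28T00:32Z): the proposed child C4 `PSLineHeightDichotomyAtThree` «∀ row ∃ D2 datum with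
`h_ψ(P,P) ≠ 0 ∨ h_ψ̄(P,P) ≠ 0`» is provable by junk on every rank-one row (`c4Shape_by_junk`, granted
the route's PUB item for `rank E(ℚ) = 1`), so it certifies nothing about the Nekovář–Benois height;
and no child that lets the datum vary (∀ or ∃) can pin the height VALUE the GZ₃ / READ children need
(companion file §2–§3). Instance note: the tree's generic-field Mordell–Weil vocabulary carries the
classical `DecidableEq`, the `ℚ`-specific D2 structure the decidable one; the transport is the tree's
(`IsMordellWeilBasis.not_isOfFinAddOrder_rat`, `convert`).
[cite: Benois2020, §0.3 (Thm. I–III)] [cite: SilvermanAEC2009, Thm. VIII.6.7]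
-/

set_option autoImplicit false
-- single-conjunct summit: `Summit.BirchSwinnertonDyer.BirchSwinnertonDyer.…` repeats the name by design
set_option linter.dupNamespace false

noncomputable section

open scoped Classical

open WeierstrassCurve Literature.NumberTheory.EllipticCurves
  Summit.BirchSwinnertonDyer.BirchSwinnertonDyer.Theses.CyclotomicUntwist

namespace Summit.BirchSwinnertonDyer.BirchSwinnertonDyer.Theorems.CyclotomicUntwistLineHeightJunkDatum

/-! ### A non-degenerate junk line-height datum from any non-torsion point (the split spec's C4 by junk) -/

section Junk

variable {W : WeierstrassCurve ℚ}

/-- **An additive `ℚ`-valued function on `E(K)` taking the value `1` at a non-torsion point**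
(`K` a number field). Mordell–Weil (tree theorem `module_finite_point_holds`) makes `E(K)/tors` a
free `ℤ`-module (`module_free_mordellWeilModTorsion`); a non-torsion `P` has a non-zero coordinate `n`
in a `ℤ`-basis, and `coord/n` composed with the projection is the function. (Stated with a bare
function and its additivity, over a general number field, so that the group law is the one of the
tree's `mordellWeilModTorsion`; transported to `E(ℚ)` below.) [cite: SilvermanAEC2009, Thm. VIII.6.7] -/
theorem exists_additive_apply_eq_one {K : Type*} [Field K] [NumberField K] {V : WeierstrassCurve K}
    [V.IsElliptic] (P : V.toAffine.Point) (hP : ¬ IsOfFinAddOrder P) :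
    ∃ φ : V.toAffine.Point → ℚ, (∀ x y, φ (x + y) = φ x + φ y) ∧ φ P = 1 := by
  haveI : Module.Free ℤ (mordellWeilModTorsion V) :=
    module_free_mordellWeilModTorsion V V.module_finite_point_holds
  set π : V.toAffine.Point →+ mordellWeilModTorsion V := QuotientAddGroup.mk' _ with hπ
  have hPbar : π P ≠ 0 := by
    intro h
    apply hP
    exact (AddCommGroup.mem_torsion P).mp ((QuotientAddGroup.eq_zero_iff P).mp h)
  set b := Module.Free.chooseBasis ℤ (mordellWeilModTorsion V) with hb
  have hrepr : b.repr (π P) ≠ 0 := fun h ↦ hPbar (b.repr.map_eq_zero_iff.mp h)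
  obtain ⟨i, hi⟩ : ∃ i, b.repr (π P) i ≠ 0 :=
    not_forall.mp fun hall ↦ hrepr (Finsupp.ext hall)
  set n : ℤ := b.repr (π P) i with hn
  have hnq : (n : ℚ) ≠ 0 := by exact_mod_cast hi
  refine ⟨fun x ↦ (n : ℚ)⁻¹ * ((b.coord i (π x) : ℤ) : ℚ), fun x y ↦ ?_, ?_⟩
  · show (n : ℚ)⁻¹ * ((b.coord i (π (x + y)) : ℤ) : ℚ) =
      (n : ℚ)⁻¹ * ((b.coord i (π x) : ℤ) : ℚ) + (n : ℚ)⁻¹ * ((b.coord i (π y) : ℤ) : ℚ)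
    rw [map_add, map_add, Int.cast_add, mul_add]
  · show (n : ℚ)⁻¹ * ((b.coord i (π P) : ℤ) : ℚ) = 1
    rw [Module.Basis.coord_apply, ← hn, inv_mul_cancel₀ hnq]

/-- **An additive functional `E(ℚ) → ℚ` taking the value `1` at a non-torsion point** (the previous
lemma at `K = ℚ`, for the group law with decidable equality on `ℚ` used by `PSLineHeightData`; the two
`DecidableEq ℚ` instances agree, `convert`). [cite: SilvermanAEC2009, Thm. VIII.6.7] -/
theorem exists_addMonoidHom_rat_apply_eq_one [W.IsElliptic] (P : W.toAffine.Point)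
    (hP : ¬ IsOfFinAddOrder P) : ∃ φ : W.toAffine.Point →+ ℚ, φ P = 1 := by
  obtain ⟨φ, hadd, hφ⟩ := exists_additive_apply_eq_one (V := W) P (by convert hP)
  -- additivity for the group law with `instDecidableEqRat` (same shape, subsingleton instances)
  have hadd' : ∀ x y : W.toAffine.Point, φ (x + y) = φ x + φ y := fun x y ↦ by
    convert hadd x y
  exact ⟨AddMonoidHom.mk' φ hadd', hφ⟩

/-- **Junk non-degenerate line-height datum.** For any coefficient ring `R` over `ℚ₃` and any
NON-TORSION point `P ∈ E(ℚ)` there is a datum `Dh : W.PSLineHeightData R` whose pairing equals `1` at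
`(P, P)` on EVERY line `χ` (`χ³ = 1`, `χ ≠ 1`): `h_χ(x, y) = φ(x) φ(y)` on lines, `0` off lines, with
`φ : E(ℚ) → ℚ ⊂ R` additive and `φ(P) = 1`; symmetry, torsion-vanishing, the line clause and Galois
equivariance (`σ` fixes `ℚ₃ ⊇ ℚ` and permutes the lines) are immediate. So the D2 structure does not
single out the Nekovář–Benois height even up to non-degeneracy, and C4 «∃ datum with
`h_ψ(P,P) ≠ 0 ∨ h_ψ̄(P,P) ≠ 0`» is provable by junk. [cite: Benois2020, §0.3 (Thm. II–III)] -/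
theorem exists_lineHeightDatum_pairing_eq_one [W.IsElliptic] {R : Type*} [CommRing R]
    [Algebra ℚ_[3] R] (P : W.toAffine.Point) (hP : ¬ IsOfFinAddOrder P) :
    ∃ Dh : W.PSLineHeightData R,
      ∀ χ : DirichletCharacter R 9, χ ^ 3 = 1 → χ ≠ 1 → Dh.pairing χ P P = 1 := by
  obtain ⟨φ, hφ⟩ := exists_addMonoidHom_rat_apply_eq_one P hP
  -- the additive map `f = ι_R ∘ φ : E(ℚ) → R` and the symmetric form `B(x, y) = f x * f y`
  set f : W.toAffine.Point →+ R :=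
    ((algebraMap ℚ_[3] R : ℚ_[3] →+* R) : ℚ_[3] →+ R).comp
      (((algebraMap ℚ ℚ_[3] : ℚ →+* ℚ_[3]) : ℚ →+ ℚ_[3]).comp φ) with hf
  set B : W.toAffine.Point →+ W.toAffine.Point →+ R :=
    ((AddMonoidHom.mul : R →+ R →+ R).comp f).compl₂ f with hB
  have hBapply : ∀ x y, B x y = f x * f y := fun x y ↦ rfl
  have hfP : f P = 1 := by
    simp [hf, hφ]
  have hftors : ∀ x : W.toAffine.Point, IsOfFinAddOrder x → f x = 0 := by
    intro x hx
    obtain ⟨n, hn, hnx⟩ := (isOfFinAddOrder_iff_nsmul_eq_zero).mp hx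
    have hφx : φ x = 0 := by
      have h := congrArg φ hnx
      rw [map_nsmul, map_zero, nsmul_eq_mul] at h
      rcases mul_eq_zero.mp h with h | h
      · exact absurd (by exact_mod_cast h : n = 0) hn.ne'
      · exact h
    simp [hf, hφx]
  have hσf : ∀ (σ : R ≃ₐ[ℚ_[3]] R) (x : W.toAffine.Point), σ (f x) = f x := by
    intro σ x
    simp only [hf, AddMonoidHom.coe_comp, AddMonoidHom.coe_coe, Function.comp_apply]
    exact σ.commutes _
  -- invariance of the line predicate under coefficient automorphisms
  have hline : ∀ (σ : R ≃ₐ[ℚ_[3]] R) (χ : DirichletCharacter R 9),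
      ((χ.ringHomComp (σ : R →+* R)) ^ 3 = 1 ∧ χ.ringHomComp (σ : R →+* R) ≠ 1) ↔
        (χ ^ 3 = 1 ∧ χ ≠ 1) := by
    intro σ χ
    have hinj : Function.Injective (σ : R →+* R) := fun a b h ↦ σ.injective h
    rw [MulChar.ringHomComp_pow, MulChar.ringHomComp_eq_one_iff hinj,
      MulChar.ringHomComp_ne_one_iff hinj]
  refine ⟨{ pairing := fun χ ↦ if χ ^ 3 = 1 ∧ χ ≠ 1 then B else 0
            symm := fun χ x y ↦ ?_
            map_torsion := fun χ x y hx ↦ ?_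
            eq_zero_of_not_isLine := fun χ hχ ↦ if_neg hχ
            conj := fun σ χ x y ↦ ?_ }, fun χ h3 h1 ↦ ?_⟩
  · show (if χ ^ 3 = 1 ∧ χ ≠ 1 then B else 0) x y = (if χ ^ 3 = 1 ∧ χ ≠ 1 then B else 0) y x
    split_ifs
    · rw [hBapply, hBapply, mul_comm]
    · rfl
  · show (if χ ^ 3 = 1 ∧ χ ≠ 1 then B else 0) x y = 0
    split_ifs
    · rw [hBapply, hftors x hx, zero_mul]
    · rfl
  · show (if (χ.ringHomComp (σ : R →+* R)) ^ 3 = 1 ∧ χ.ringHomComp (σ : R →+* R) ≠ 1 then B else 0)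
        x y = σ ((if χ ^ 3 = 1 ∧ χ ≠ 1 then B else 0) x y)
    rw [if_congr (hline σ χ) rfl rfl]
    split_ifs
    · rw [hBapply, map_mul, hσf, hσf]
    · rw [AddMonoidHom.zero_apply, AddMonoidHom.zero_apply, map_zero]
  · show (if χ ^ 3 = 1 ∧ χ ≠ 1 then B else 0) P P = 1
    rw [if_pos ⟨h3, h1⟩, hBapply, hfP, one_mul]

/-- **C4 as spelled holds by junk on every rank-one row.** Granted the route's PUB item (`rank E(ℚ) =
r_an = 1`), an `r_an = 1` curve has a non-torsion point (a Mordell–Weil basis element, tree theorem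
`exists_isMordellWeilBasis_holds`), hence for any coefficient ring `R` and any line `ψ` a datum with
`h_ψ(P,P) = 1` — in particular the dichotomy «`h_ψ(P,P) ≠ 0 ∨ h_ψ̄(P,P) ≠ 0`» — exists, whatever the
Nekovář–Benois height does. [cite: Benois2020, §0.3 (Thm. II–III)] [cite: SilvermanAEC2009, Thm. VIII.6.7] -/
theorem c4Shape_by_junk [W.IsElliptic] (hGZK : PublishedInputGZK) (hr : W.analyticRank = 1)
    {R : Type*} [CommRing R] [Algebra ℚ_[3] R] [Nontrivial R] (ψ : DirichletCharacter R 9)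
    (hψ : ψ ^ 3 = 1) (hψ1 : ψ ≠ 1) :
    ∃ (Dh : W.PSLineHeightData R) (P : W.toAffine.Point),
      Dh.pairing ψ P P = 1 ∧ (Dh.pairing ψ P P ≠ 0 ∨ Dh.pairing ψ⁻¹ P P ≠ 0) := by
  have hrank : W.mordellWeilRank = 1 := by rw [(hGZK W hr.le).1, hr]
  obtain ⟨Pb, hPb⟩ := W.exists_isMordellWeilBasis_holds
  -- a Mordell–Weil basis element is non-torsion (tree lemma, instance transport included)
  have k : Fin W.mordellWeilRank := ⟨0, by omega⟩
  set P : W.toAffine.Point := Pb k with hPdef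
  have hP : ¬ IsOfFinAddOrder P := hPb.not_isOfFinAddOrder_rat k
  obtain ⟨Dh, hDh⟩ := exists_lineHeightDatum_pairing_eq_one (R := R) P hP
  refine ⟨Dh, P, hDh ψ hψ hψ1, Or.inl ?_⟩
  rw [hDh ψ hψ hψ1]
  exact one_ne_zero

end Junk

end Summit.BirchSwinnertonDyer.BirchSwinnertonDyer.Theorems.CyclotomicUntwistLineHeightJunkDatum

end
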